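import Summits.CriticalPhenomena.PercolationContinuityZ3.Theorems.PercNearOneGluingNoHeavyPcintMemCertSym
import Summits.CriticalPhenomena.PercolationContinuityZ3.Theorems.PercNearOneGluingNoHeavyPcintNawRandWindowCert
import HarnessLib

/-!
# PCINT lane, reduction B2r on the memory-`τ` DANGEROUS-SET automaton (reduced-state certificates for `p_c^site(ℤ^d)`)

Cell `prim-pcint` (PAPER-2 track (iii): certified intervals for `p_c(ℤ^d)`), seat `prim-pcint-1` (gen 5); support file
(`--supports stmt-CriticalPhenomena-4575`).  Does NOT build on p205010.  Lane files: run/shared/lean/prim/pcint/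
(REDUCTIONS.md §B2r, INTERVAL-PLAN §16 "checker for the reduced-state automata").

The B2r weight of a neighbour-avoiding word `γ` (`…PcintNawRandDefs`: `nawRandWeight p q γ = p^{n+1} q^{gapTotal γ}
((1+q)/2)^{cornerTotal γ}`, with `θ^site(p) ≤ Σ_{γ ∈ NAW_n} nawRandWeight p q γ` whenever `q^{2d-1} ≥ 1-p`,
`…PcintNawRandReduction`) was so far dominated by WINDOW automata (states = the last `m+1` steps,
`…PcintNawRandWindowCert`).  Here the same per-step domination is carried by the much smaller memory-`τ` DANGEROUS-SET
automaton of `…PcintMemAutomaton` (`mstep τ`, `danger τ`: the remembered sites `(v_{t-j} - v_t, j)`, `1 ≤ j ≤ τ-1`,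
within `ℓ¹`-reach `τ - j`), equipped with
* the NAW rejection `nstep` (a step is refused when a remembered site equals OR IS ADJACENT TO the new vertex),
* the detected gap count `ngap` (lattice neighbours of the new vertex adjacent to a remembered site of age `≥ 2`),
* the claimed corner `ncorner` (the age-1 site is perpendicular to the step and no remembered site of age `≥ 2` is adjacent
  to the corner site),
and the weight `p · q̄^{ngap} · κ̄^{[ncorner]}` (`nawMemAut`).  PROVED here (all `d`, all `τ ≥ 2`, no `sorry`):
`nstep_danger_pre` (along a NAW word the automaton runs through the dangerous sets of the prefixes),
`ngap_le_card_gapSet` / `card_gapSet_gt_of_ncorner` (soundness of the counts, the "window" of REDUCTIONS §B2r.6 replaced by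
"remembered set"), `gapFactor_le_nwt`, `nawRandWeight_le_run`, `sum_nawRandWeight_le_total`, and the glue
`le_siteCriticalProb_zd_of_nawMem_total : (∀ n, total n ∅ ≤ C rⁿ, r < 1) → p ≤ p_c^site(ℤ^d)`.
The companion files `…PcintNawRandMemSym` (lattice symmetry, table certificates) and `…PcintNawRandMemKernel`
(kernel arithmetic) turn a finite certificate into the hypothesis of the glue theorem.

References: REDUCTIONS.md §B2r (prim-pcint-2); A. Pönitz, P. Tittmann, Electron. J. Combin. 7 (2000) R21 §2–3
[PonitzTittmann2000]; G. Grimmett, *Percolation*, 2nd ed. 1999, §1.4 (1.13)–(1.16) [GrimmettPercolation1999].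
-/

noncomputable section

namespace Summit.CriticalPhenomena.PercolationContinuityZ3.Theorems.Pcint

open Finset Literature.Probability.Percolation Literature.Probability.LatticeModels
open Literature.Probability.FitznerVanDerHofstad2017 (wordPos_wordInit)

variable {d : ℕ}

/-! ### A product formula for runs of a weighted automaton -/

namespace WAut

variable {S A : Type*} (M : WAut S A)

/-- **Runs along a known state sequence.** If `step (s t) (w t) = some (s (t+1))` for all `t < n`, the run weight from
`s 0` is the product of the transition weights. [folklore] -/
theorem run_eq_prod_of_states : ∀ (n : ℕ) (s : ℕ → S) (w : Fin n → A),
    (∀ (t : ℕ) (ht : t < n), M.step (s t) (w ⟨t, ht⟩) = some (s (t + 1))) →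
    M.run n (s 0) w = ∏ t ∈ range n, if ht : t < n then M.wt (s t) (w ⟨t, ht⟩) else 1
  | 0, s, w, _ => by simp [run]
  | n + 1, s, w, h => by
    have h0 : M.step (s 0) (w 0) = some (s 1) := h 0 (Nat.succ_pos n)
    simp only [run, h0]
    have ih := run_eq_prod_of_states n (fun t => s (t + 1)) (Fin.tail w) (fun t ht => by
      have := h (t + 1) (by omega)
      simpa [Fin.tail] using this)
    rw [ih, prod_range_succ' _ n]
    simp only [Nat.succ_pos, dite_true, mul_comm]
    congr 1
    refine prod_congr rfl fun t ht => ?_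
    have ht' := mem_range.1 ht
    simp only [ht', dite_true, show t + 1 < n + 1 by omega, Fin.tail]
    rfl

/-- The total weight dominates the sum of the (nonnegative) run weights over any set of words. [folklore] -/
theorem sum_run_le_total [Fintype A] [DecidableEq A] (n : ℕ) (s : S) (T : Finset (Fin n → A)) :
    ∑ w ∈ T, M.run n s w ≤ M.total n s :=
  sum_le_sum_of_subset_of_nonneg (subset_univ T) fun w _ _ => M.run_nonneg n s w

end WAut

/-! ### The B2r automaton on dangerous-set states -/
/-- **NAW step** of the dangerous-set automaton: refused iff a remembered site is ADJACENT to the new vertex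
(landing ON a remembered site is refused by `mstep` itself); otherwise the memory-`τ` update of `mstep`. [folklore] -/
def nstep (τ : ℕ) (S : MState d) (a : Fin d × Bool) : Option (MState d) :=
  if ∃ q ∈ S, (zdGraph d).Adj q.1 (stepVec a) then none else mstep τ S a

/-- The DETECTED gap sites of a step: lattice neighbours `w` of the new vertex (relative to the current endpoint)
adjacent to a remembered site of age at least two. [folklore] -/
def ngapSet (S : MState d) (a : Fin d × Bool) : Finset (Site d) :=
  (nbrSites (stepVec a)).filter fun w => ∃ q ∈ S, 2 ≤ q.2 ∧ (zdGraph d).Adj q.1 w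

/-- The detected gap count. [folklore] -/
def ngap (S : MState d) (a : Fin d × Bool) : ℕ := (ngapSet S a).card

/-- The detected gap count is at most `2d`. [folklore] -/
theorem ngap_le (S : MState d) (a : Fin d × Bool) : ngap S a ≤ 2 * d :=
  (card_filter_le _ _).trans (card_nbrSites_le _)
/-- The CLAIMED corner of a step (as a Boolean): the remembered age-1 site `r₁` (the previous vertex) is perpendicular
to the step and no remembered site of age `≥ 2` is adjacent to the corner site `r₁ + e`. [folklore] -/
def ncorner (S : MState d) (a : Fin d × Bool) : Bool :=
  decide (∃ q₁ ∈ S, q₁.2 = 1 ∧ q₁.1 a.1 = 0 ∧ ∀ q ∈ S, 2 ≤ q.2 → ¬ (zdGraph d).Adj q.1 (q₁.1 + stepVec a))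

/-- The B2r step factor `q̄^{ngap} · κ̄^{[ncorner]}`. [folklore] -/
def nwt (qb κb : ℝ) (S : MState d) (a : Fin d × Bool) : ℝ :=
  qb ^ ngap S a * (if ncorner S a then κb else 1)

/-- The step factor is nonnegative. [folklore] -/
theorem nwt_nonneg {qb κb : ℝ} (hqb : 0 ≤ qb) (hκb : 0 ≤ κb) (S : MState d) (a : Fin d × Bool) :
    0 ≤ nwt qb κb S a := by
  unfold nwt; split_ifs <;> positivity

/-- **The B2r automaton on dangerous-set states** with weight `p · q̄^{ngap} · κ̄^{[ncorner]}`. [folklore] -/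
def nawMemAut (τ : ℕ) (p qb κb : ℝ) (hp : 0 ≤ p) (hqb : 0 ≤ qb) (hκb : 0 ≤ κb) :
    WAut (MState d) (Fin d × Bool) where
  step := nstep τ
  wt S a := p * nwt qb κb S a
  wt_nonneg S a := mul_nonneg hp (nwt_nonneg hqb hκb S a)

/-! ### Prefixes of a word -/

section Prefix

variable (a₀ : Fin d × Bool) {n : ℕ}

/-- The prefix of length `t` of a word (junk-padded beyond its end). [folklore] -/
def pre (γ : Fin n → Fin d × Bool) (t : ℕ) : Fin t → Fin d × Bool := fun i => wordAt a₀ γ i.1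

/-- Dropping the last letter of a prefix gives the shorter prefix. [folklore] -/
theorem wordInit_pre (γ : Fin n → Fin d × Bool) (t : ℕ) : wordInit (pre a₀ γ (t + 1)) = pre a₀ γ t := rfl

/-- The last letter of a prefix inside the word. [folklore] -/
theorem pre_last (γ : Fin n → Fin d × Bool) {t : ℕ} (ht : t < n) : pre a₀ γ (t + 1) (Fin.last t) = γ ⟨t, ht⟩ := by
  simp [pre, wordAt_of_lt a₀ γ ht]

/-- Positions along a prefix are positions along the word. [folklore] -/
theorem wordPos_pre (γ : Fin n → Fin d × Bool) {t : ℕ} (ht : t ≤ n) : ∀ {i : ℕ}, i ≤ t →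
    wordPos (pre a₀ γ t) i = wordPos γ i
  | 0, _ => by simp
  | i + 1, hi => by
    rw [wordPos_succ _ (show i < t by omega), wordPos_succ _ (show i < n by omega), wordPos_pre γ ht (by omega)]
    simp [pre, wordAt_of_lt a₀ γ (show i < n by omega)]

/-- Prefixes of a self-avoiding word are self-avoiding. [folklore] -/
theorem isSAW_pre {γ : Fin n → Fin d × Bool} (h : IsSAW γ) {t : ℕ} (ht : t ≤ n) : IsSAW (pre a₀ γ t) := by
  intro i j hi hj hij
  rw [wordPos_pre a₀ γ ht hi, wordPos_pre a₀ γ ht hj] at hij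
  exact h i j (by omega) (by omega) hij

end Prefix

/-! ### Soundness along a neighbour-avoiding word -/
section Sound

variable (a₀ : Fin d × Bool) {τ n : ℕ} {γ : Fin n → Fin d × Bool}

/-- Remembered sites are earlier vertices seen from the current one. [folklore] -/
theorem eq_of_mem_danger_pre {t : ℕ} (ht : t ≤ n) {q : Site d × ℕ} (hq : q ∈ danger τ (pre a₀ γ t)) :
    1 ≤ q.2 ∧ q.2 ≤ t ∧ q.1 = wordPos γ (t - q.2) - wordPos γ t := by
  obtain ⟨h1, -, h3, h4, -⟩ := (mem_danger _ q).1 hq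
  exact ⟨h1, h3, by rw [h4, wordPos_pre a₀ γ ht (by omega), wordPos_pre a₀ γ ht le_rfl]⟩

/-- **The run follows the dangerous sets**: along a neighbour-avoiding word, reading letter `t` from the dangerous set of
the prefix of length `t` is accepted by `nstep` and yields the dangerous set of the prefix of length `t + 1`. [folklore] -/
theorem nstep_danger_pre (hτ : 2 ≤ τ) (hs : IsSAW γ) (hch : chordEdges γ = ∅) {t : ℕ} (ht : t < n) :
    nstep τ (danger τ (pre a₀ γ t)) (γ ⟨t, ht⟩) = some (danger τ (pre a₀ γ (t + 1))) := by
  unfold nstep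
  rw [if_neg]
  · rw [← wordInit_pre a₀ γ t, ← pre_last a₀ γ ht]
    exact mstep_danger_wordInit hτ _ (isMem_of_isSAW τ (isSAW_pre a₀ hs (by omega)))
  · rintro ⟨q, hq, hadj⟩
    obtain ⟨h1, h2, hq1⟩ := eq_of_mem_danger_pre a₀ ht.le hq
    rw [hq1, ← Literature.Probability.RandomPlanarGeometry.SAW.Zd.zdGraph_adj_sub_right _ _ (-wordPos γ t),
      sub_neg_eq_add, sub_add_cancel, sub_neg_eq_add, add_comm, ← wordPos_succ γ ht] at hadj
    rcases consecutive_of_adj hch (by omega) (by omega) hadj with h | h <;> omega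

/-- Translating a detected gap site to absolute coordinates gives a genuine gap site at time `t + 1`. [folklore] -/
theorem add_mem_gapSet_of_mem_ngapSet (hch : chordEdges γ = ∅) {t : ℕ} (ht : t < n) {w : Site d}
    (hw : w ∈ ngapSet (danger τ (pre a₀ γ t)) (γ ⟨t, ht⟩)) : w + wordPos γ t ∈ gapSet γ (t + 1) := by
  rw [ngapSet, mem_filter, mem_nbrSites] at hw
  obtain ⟨hadj, q, hq, hq2, hqw⟩ := hw
  obtain ⟨h1, h2, hq1⟩ := eq_of_mem_danger_pre a₀ ht.le hq
  have hadj' : (zdGraph d).Adj (wordPos γ (t + 1)) (w + wordPos γ t) := by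
    rw [wordPos_succ γ ht, ← Literature.Probability.RandomPlanarGeometry.SAW.Zd.zdGraph_adj_sub_right _ _ (wordPos γ t)]
    simpa [add_sub_cancel_left] using hadj
  have hqw' : (zdGraph d).Adj (wordPos γ (t - q.2)) (w + wordPos γ t) := by
    rw [← Literature.Probability.RandomPlanarGeometry.SAW.Zd.zdGraph_adj_sub_right _ _ (wordPos γ t), ← hq1]
    simpa using hqw
  refine mem_gapSet.2 ⟨hadj', ?_, t - q.2, by omega, hqw'⟩
  intro hmem
  obtain ⟨k, hk, hkw⟩ := mem_pathSites.1 hmem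
  rw [← hkw] at hadj' hqw'
  rcases consecutive_of_adj hch (by omega) hk hadj' with h | h <;>
    rcases consecutive_of_adj hch (by omega) hk hqw' with h' | h' <;> omega

/-- **Detected gaps are genuine**: `ngap ≤ #gapSet γ (t+1)`. [folklore] -/
theorem ngap_le_card_gapSet (hch : chordEdges γ = ∅) {t : ℕ} (ht : t < n) :
    ngap (danger τ (pre a₀ γ t)) (γ ⟨t, ht⟩) ≤ (gapSet γ (t + 1)).card := by
  unfold ngap
  calc (ngapSet _ _).card = ((ngapSet (danger τ (pre a₀ γ t)) (γ ⟨t, ht⟩)).image fun w => w + wordPos γ t).card :=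
        (card_image_of_injective _ (add_left_injective (wordPos γ t))).symm
    _ ≤ (gapSet γ (t + 1)).card := card_le_card fun x hx => by
        obtain ⟨w, hw, rfl⟩ := mem_image.1 hx
        exact add_mem_gapSet_of_mem_ngapSet a₀ hch ht hw

/-- Coordinates of a unit step: `±1` on its own axis. [folklore] -/
theorem stepVec_apply_fst (a : Fin d × Bool) : stepVec a a.1 = if a.2 then 1 else -1 := by
  rcases a with ⟨i, b⟩; cases b <;> simp [stepVec]
/-- Coordinates of a unit step: `0` off its axis. [folklore] -/
theorem stepVec_apply_of_ne (a : Fin d × Bool) {i : Fin d} (hi : i ≠ a.1) : stepVec a i = 0 := by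
  rcases a with ⟨j, b⟩; cases b <;> simp [stepVec, hi]

/-- Unit steps with a common nonzero coordinate lie on the same axis. [folklore] -/
theorem fst_eq_of_stepVec_eq {a b : Fin d × Bool} (h : stepVec a = stepVec b) : a.1 = b.1 := by
  by_contra hne
  have h1 := congrFun h a.1
  rw [stepVec_apply_fst, stepVec_apply_of_ne b hne] at h1
  revert h1; split_ifs <;> norm_num

/-- A site and its translate by minus a unit step are adjacent. [folklore] -/
theorem adj_sub_stepVec (x : Site d) (a : Fin d × Bool) : (zdGraph d).Adj x (x - stepVec a) :=
  ((zdGraph_adj_iff_stepVec _ _).2 ⟨a, (sub_add_cancel x (stepVec a)).symm⟩).symm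

/-- **A claimed corner that is not a genuine corner is an undetected genuine gap**: then `ngap < #gapSet γ (t+1)`.
[folklore] -/
theorem ngap_lt_card_gapSet (hch : chordEdges γ = ∅) {t : ℕ} (ht : t < n)
    (hc : ncorner (danger τ (pre a₀ γ t)) (γ ⟨t, ht⟩) = true) (hnot : ¬ (2 ≤ t + 1 ∧ IsCorner γ (t + 1 - 2))) :
    ngap (danger τ (pre a₀ γ t)) (γ ⟨t, ht⟩) < (gapSet γ (t + 1)).card := by
  obtain ⟨q₁, hq₁, hage, hperp, hfree⟩ := of_decide_eq_true hc
  obtain ⟨-, h2, hr₁⟩ := eq_of_mem_danger_pre a₀ ht.le hq₁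
  rw [hage] at h2 hr₁
  have ht1 : 1 ≤ t := h2
  have htm : t - 1 < n := by omega
  set e := stepVec (γ ⟨t, ht⟩) with he
  set s₁ := stepVec (γ ⟨t - 1, htm⟩) with hs₁
  have hprev : wordPos γ t = wordPos γ (t - 1) + s₁ := by
    conv_lhs => rw [show t = t - 1 + 1 by omega]
    exact wordPos_succ γ htm
  have hr₁' : q₁.1 = -s₁ := by rw [hr₁, hprev]; abel
  have hnext : wordPos γ (t + 1) = wordPos γ t + e := wordPos_succ γ ht
  -- the corner site, absolute and relative
  set C := cornerSite γ (t - 1) with hC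
  have hCdef : C = wordPos γ (t - 1) + e := by
    rw [hC, cornerSite, dif_pos (show t - 1 + 1 < n by omega), he]
    congr 3; exact Fin.ext (by simp only; omega)
  have hCrel : q₁.1 + e + wordPos γ t = C := by rw [hCdef, hr₁]; abel
  -- the two steps are along different axes
  have haxes : (γ ⟨t - 1, htm⟩).1 ≠ (γ ⟨t, ht⟩).1 := by
    intro hax
    have h0 : q₁.1 (γ ⟨t, ht⟩).1 = 0 := hperp
    rw [hr₁', Pi.neg_apply, ← hax, hs₁, stepVec_apply_fst] at h0
    revert h0; split_ifs <;> norm_num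
  -- C ~ v_{t+1} and C ~ v_{t-1}
  have hC1 : (zdGraph d).Adj (wordPos γ (t + 1)) C := by
    have : C = wordPos γ (t + 1) - s₁ := by rw [hCdef, hnext, hprev]; abel
    rw [this, hs₁]; exact adj_sub_stepVec _ _
  have hC2 : (zdGraph d).Adj (wordPos γ (t - 1)) C := by
    rw [hCdef, he, zdGraph_adj_iff_stepVec]; exact ⟨_, rfl⟩
  -- C is off the path
  have hCoff : C ∉ pathSites γ := by
    intro hmem
    obtain ⟨k, hk, hkC⟩ := mem_pathSites.1 hmem
    rw [← hkC] at hC1 hC2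
    rcases consecutive_of_adj hch (by omega) hk hC1 with h | h
    · rcases consecutive_of_adj hch (by omega) hk hC2 with h' | h' <;> omega
    · have hkt : k = t := by omega
      subst hkt
      apply haxes
      apply fst_eq_of_stepVec_eq
      rw [← hs₁, ← he]
      have := hkC
      rw [hCdef, hprev] at this
      exact add_left_cancel this
  -- since the claimed corner is not genuine, some vertex older than v_{t-1} is adjacent to C
  have hold : ∃ i, i < t - 1 ∧ (zdGraph d).Adj (wordPos γ i) C := by
    by_contra hno
    push Not at hno
    apply hnot
    refine ⟨by omega, ?_⟩
    rw [show t + 1 - 2 = t - 1 by omega]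
    refine ⟨by omega, ?_, hCoff, fun i hi => hno i (mem_range.1 hi)⟩
    have e1 : (⟨t - 1 + 1, by omega⟩ : Fin n) = ⟨t, ht⟩ := Fin.ext (by simp only; omega)
    rw [e1]; exact haxes
  obtain ⟨i, hi, hiC⟩ := hold
  -- so C is a genuine gap site at time t+1 ...
  have hCgap : C ∈ gapSet γ (t + 1) := mem_gapSet.2 ⟨hC1, hCoff, i, by omega, hiC⟩
  -- ... which is not detected (no remembered site of age ≥ 2 is adjacent to the corner site)
  have hCnot : C ∉ (ngapSet (danger τ (pre a₀ γ t)) (γ ⟨t, ht⟩)).image fun w => w + wordPos γ t := by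
    intro hmem
    obtain ⟨w, hw, hwC⟩ := mem_image.1 hmem
    have hw' : w = q₁.1 + e := add_right_cancel (hwC.trans hCrel.symm)
    rw [ngapSet, mem_filter] at hw
    obtain ⟨-, q, hq, hq2, hqw⟩ := hw
    rw [hw'] at hqw
    exact hfree q hq hq2 hqw
  unfold ngap
  calc (ngapSet _ _).card = ((ngapSet (danger τ (pre a₀ γ t)) (γ ⟨t, ht⟩)).image fun w => w + wordPos γ t).card :=
        (card_image_of_injective _ (add_left_injective (wordPos γ t))).symm
    _ < (gapSet γ (t + 1)).card := by
        refine card_lt_card ⟨fun x hx => ?_, fun hsub => hCnot (hsub hCgap)⟩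
        obtain ⟨w, hw, rfl⟩ := mem_image.1 hx
        exact add_mem_gapSet_of_mem_ngapSet a₀ hch ht hw

/-- **Per-step domination** (REDUCTIONS §B2r.6 with "remembered set" for "window"): for a neighbour-avoiding word the full
B2r factor at time `t + 1` is at most the automaton's factor `q̄^{ngap} κ̄^{[ncorner]}` read from the dangerous set of the
prefix of length `t`, whenever `0 ≤ q ≤ q̄ ≤ 1` and `(1+q̄)/2 ≤ κ̄`. [folklore] -/
theorem gapFactor_le_nwt (hch : chordEdges γ = ∅) {t : ℕ} (ht : t < n)
    {q qb κb : ℝ} (hq0 : 0 ≤ q) (hqb : q ≤ qb) (hqb1 : qb ≤ 1) (hκb : (1 + qb) / 2 ≤ κb) :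
    gapFactor q ((1 + q) / 2) γ (t + 1) ≤ nwt qb κb (danger τ (pre a₀ γ t)) (γ ⟨t, ht⟩) := by
  classical
  have hq1 : q ≤ 1 := hqb.trans hqb1
  have hqκ : q ≤ κb := by linarith
  have hg := ngap_le_card_gapSet a₀ (τ := τ) hch ht
  have hpow : q ^ (gapSet γ (t + 1)).card ≤ qb ^ ngap (danger τ (pre a₀ γ t)) (γ ⟨t, ht⟩) :=
    (pow_le_pow_of_le_one hq0 hq1 hg).trans (pow_le_pow_left₀ hq0 hqb _)
  unfold gapFactor nwt
  by_cases hc : ncorner (danger τ (pre a₀ γ t)) (γ ⟨t, ht⟩) = true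
  · rw [if_pos hc]
    split_ifs with hcor
    · exact mul_le_mul hpow (by linarith) (by linarith) (pow_nonneg (hq0.trans hqb) _)
    · rw [mul_one]
      have hlt := ngap_lt_card_gapSet a₀ hch ht hc hcor
      calc q ^ (gapSet γ (t + 1)).card ≤ q ^ (ngap (danger τ (pre a₀ γ t)) (γ ⟨t, ht⟩) + 1) :=
            pow_le_pow_of_le_one hq0 hq1 (by omega)
        _ = q ^ ngap (danger τ (pre a₀ γ t)) (γ ⟨t, ht⟩) * q := pow_succ _ _
        _ ≤ qb ^ ngap (danger τ (pre a₀ γ t)) (γ ⟨t, ht⟩) * κb :=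
            mul_le_mul (pow_le_pow_left₀ hq0 hqb _) hqκ hq0 (pow_nonneg (hq0.trans hqb) _)
  · rw [if_neg hc, mul_one]
    split_ifs
    · exact (mul_le_of_le_one_right (pow_nonneg hq0 _) (by linarith)).trans hpow
    · rw [mul_one]; exact hpow

/-- The time-`0` factor is trivial: no gap and no corner before the first step. [folklore] -/
theorem gapFactor_zero (q κ : ℝ) (γ : Fin n → Fin d × Bool) : gapFactor q κ γ 0 = 1 := by
  classical
  unfold gapFactor
  have : gapSet γ 0 = ∅ := by
    rw [Finset.eq_empty_iff_forall_notMem]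
    intro w hw
    obtain ⟨-, -, i, hi, -⟩ := mem_gapSet.1 hw
    omega
  rw [this, card_empty, pow_zero, one_mul, if_neg (by omega)]

include a₀ in
/-- **Domination of the B2r weight by the run** of `nawMemAut` from the empty state, for a neighbour-avoiding word.
[folklore] -/
theorem nawRandWeight_le_run (hτ : 2 ≤ τ) (hs : IsSAW γ) (hch : chordEdges γ = ∅) (p : unitInterval)
    {q qb κb : ℝ} (hq0 : 0 ≤ q) (hqb : q ≤ qb) (hqb1 : qb ≤ 1) (hκb : (1 + qb) / 2 ≤ κb) :
    nawRandWeight p q γ ≤ (p : ℝ) * (nawMemAut τ p qb κb p.2.1 (hq0.trans hqb) (by linarith)).run n ∅ γ := by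
  classical
  have hp0 : (0 : ℝ) ≤ p := p.2.1
  set M := nawMemAut (d := d) τ p qb κb p.2.1 (hq0.trans hqb) (by linarith) with hM
  have hrun := M.run_eq_prod_of_states n (fun t => danger τ (pre a₀ γ t)) γ (fun t ht => by
    rw [hM]; exact nstep_danger_pre a₀ hτ hs hch ht)
  have h0 : danger τ (pre a₀ γ 0) = ∅ := danger_zero τ _
  rw [h0] at hrun
  rw [hrun, nawRandWeight_eq_prod, prod_range_succ' _ n, gapFactor_zero, mul_one, pow_succ, mul_comm _ (p : ℝ),
    mul_assoc]
  refine mul_le_mul_of_nonneg_left ?_ hp0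
  have hwt : ∀ (t : ℕ) (ht : t < n), M.wt (danger τ (pre a₀ γ t)) (γ ⟨t, ht⟩) =
      (p : ℝ) * nwt qb κb (danger τ (pre a₀ γ t)) (γ ⟨t, ht⟩) := fun t ht => by rw [hM]; rfl
  calc (p : ℝ) ^ n * ∏ t ∈ range n, gapFactor q ((1 + q) / 2) γ (t + 1)
      = ∏ t ∈ range n, ((p : ℝ) * gapFactor q ((1 + q) / 2) γ (t + 1)) := by
        rw [prod_mul_distrib, prod_const, card_range]
    _ ≤ ∏ t ∈ range n, (if ht : t < n then M.wt (danger τ (pre a₀ γ t)) (γ ⟨t, ht⟩) else 1) := by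
        refine prod_le_prod (fun t _ => mul_nonneg hp0 (gapFactor_nonneg hq0 (by linarith) γ _)) fun t ht => ?_
        have ht' := mem_range.1 ht
        rw [dif_pos ht', hwt t ht']
        exact mul_le_mul_of_nonneg_left (gapFactor_le_nwt a₀ hch ht' hq0 hqb hqb1 hκb) hp0

include a₀ in
/-- **Sum form**: `Σ_{γ ∈ NAW_n} nawRandWeight p q γ ≤ p · total n ∅`. [folklore] -/
theorem sum_nawRandWeight_le_total (hτ : 2 ≤ τ) (p : unitInterval) {q qb κb : ℝ} (hq0 : 0 ≤ q) (hqb : q ≤ qb)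
    (hqb1 : qb ≤ 1) (hκb : (1 + qb) / 2 ≤ κb) (n : ℕ) :
    ∑ γ ∈ (sawWords d n).filter (fun w => chordEdges w = ∅), nawRandWeight p q γ ≤
      (p : ℝ) * (nawMemAut τ p qb κb p.2.1 (hq0.trans hqb) (by linarith)).total n (∅ : MState d) := by
  classical
  set M := nawMemAut (d := d) τ p qb κb p.2.1 (hq0.trans hqb) (by linarith) with hM
  calc ∑ γ ∈ (sawWords d n).filter (fun w => chordEdges w = ∅), nawRandWeight p q γ
      ≤ ∑ γ ∈ (sawWords d n).filter (fun w => chordEdges w = ∅), (p : ℝ) * M.run n ∅ γ :=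
        sum_le_sum fun γ hγ => by
          obtain ⟨hsaw, hch⟩ := mem_filter.1 hγ
          exact nawRandWeight_le_run a₀ hτ (mem_sawWords.1 hsaw) hch p hq0 hqb hqb1 hκb
    _ = (p : ℝ) * ∑ γ ∈ (sawWords d n).filter (fun w => chordEdges w = ∅), M.run n ∅ γ := by rw [mul_sum]
    _ ≤ (p : ℝ) * M.total n ∅ := mul_le_mul_of_nonneg_left (M.sum_run_le_total n ∅ _) p.2.1

end Sound

/-! ### The glue: a geometric bound on the totals gives a lower bound on `p_c^site(ℤ^d)` -/
/-- **Reduced-state B2r certificate ⇒ `p ≤ p_c^site(ℤ^d)`.**  If the totals of the dangerous-set automaton from the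
empty state are geometrically small, `total n ∅ ≤ C rⁿ` with `r < 1`, for constants `0 ≤ q ≤ q̄ ≤ 1`, `(1+q̄)/2 ≤ κ̄`,
`q^{2d-1} ≥ 1 - p` and memory `τ ≥ 2`, then `p ≤ p_c^site(ℤ^d)`. [folklore] -/
theorem le_siteCriticalProb_zd_of_nawMem_total [NeZero d] {τ : ℕ} (hτ : 2 ≤ τ) (p : unitInterval) {q qb κb C r : ℝ}
    (hq0 : 0 ≤ q) (hqb : q ≤ qb) (hqb1 : qb ≤ 1) (hκb : (1 + qb) / 2 ≤ κb) (hpq : 1 - (p : ℝ) ≤ q ^ (2 * d - 1))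
    (hr0 : 0 ≤ r) (hr : r < 1)
    (htot : ∀ n, (nawMemAut τ p qb κb p.2.1 (hq0.trans hqb) (by linarith)).total n (∅ : MState d) ≤ C * r ^ n) :
    (p : ℝ) ≤ siteCriticalProb (zdGraph d) 0 := by
  refine le_siteCriticalProb_zd_of_nawRand_le_geometric d p hq0 (hqb.trans hqb1) hpq hr0 hr (C := (p : ℝ) * C)
    fun n => ?_
  calc _ ≤ (p : ℝ) * _ := sum_nawRandWeight_le_total ((⟨0, NeZero.pos d⟩, true) : Fin d × Bool) hτ p hq0 hqb hqb1 hκb n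
    _ ≤ (p : ℝ) * (C * r ^ n) := mul_le_mul_of_nonneg_left (htot n) p.2.1
    _ = (p : ℝ) * C * r ^ n := by ring

end Summit.CriticalPhenomena.PercolationContinuityZ3.Theorems.Pcint
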